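import Literature.Probability.RandomPlanarGeometry.LSW2004USTDriving
import Literature.Probability.RandomPlanarGeometry.USTPeanoLocal
import Mathlib.Topology.Algebra.Order.Floor
import HarnessLib

/-!
# [LSW04] §4.3: the boundary loops of the grid approximations `D^R` converge uniformly to `∂D`

G. F. Lawler, O. Schramm, W. Werner, *Conformal invariance of planar loop-erased random walks and
uniform spanning trees*, Ann. Probab. **32** (2004) 939–995 (**[LSW04]**), §4.3, p. 977: the grid
approximations `D^R = D(α^R, β^R, a^R, b^R) ∈ 𝔇*` of `(RD, Rα_D, Rβ_D)` satisfy
`ρ(α^R, Rα_D) ≤ C`, `ρ(β^R, Rβ_D) ≤ C` (`USTPeano.IsApproximation`, `C = 10`), and LSW use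
"`lim_{R → ∞} R⁻¹ φ_R⁻¹(z) = φ⁻¹(z)` uniformly in `ℍ̄` (this follows, e.g., from Cor. 2.4 in
[Po])" — the hypothesis `hconv` of `USTPeano.drivingProcess_tendsto_of_thm44`
(`LSW2004USTDriving.lean`). The tree proves Radó's theorem
(`JordanDomain.rado_tendstoUniformlyOn_holds`, Pommerenke (1992), Thm. 2.11), whose input is
uniform convergence of boundary PARAMETRISATIONS with a common parameter. This file supplies that
input for the approximations: for `D^R` an approximation of the smooth domain `D` at a scale `R`
above `D.glueScale` it constructs a Jordan-domain structure `USTPeano.IsApproximation.jordan`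
(`Domain.approxJordan`) on the rescaled domain `R⁻¹ D^R` whose boundary loop is the boundary
polygon `a, α, b, β⁻¹` of `D^R` re-timed along the boundary loop `J` of `D` — the two increasing
reparametrisations of §3.4 realising `ρ < 11` on the `α`- and `β`-blocks (`pathCurve_alpha_eq`,
`pathCurve_beta_eq` identify the blocks of the polygon with the polylines), glued with four
junction windows of a width `τ` over which `J` moves by `≤ R⁻¹` into one strictly increasing
continuous parameter change (`Domain.glueParam`, a sum of six clamped monotone profiles;
`strictMonoOn_glueParam`, `continuous_glueLoop` by `ContinuousOn.comp_fract''`,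
`injOn_glueLoop` from the simplicity of the polygon, `range_glueLoop`) — and proves
`‖glueLoop t - R · J t‖ ≤ 13` for all `t` (`Domain.norm_glueLoop_sub_le`: on a junction window
the polygon point is within `1` of `α_a, α_b, β_b, β_a`, within `11` of `R a`, `R b`, within `1`
of `R J(t)`; on a block it is the matched polyline point). Consequences, in the form consumed by
Radó's theorem: `IsApproximation.dist_jordan_boundary_le` (`≤ 13/R`),
`eventually_dist_jordan_boundary_lt` (uniform convergence of the boundary loops along `Rₙ → ∞`),
`IsApproximation.dist_a_le`, `dist_b_le` (the rescaled marked vertices are `12/R`-close to `a`,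
`b`), `IsApproximation.two_le_length` (above the gluing scale `α^R`, `β^R` have `≥ 2` points).

Everything here is PROVED (deterministic plane geometry); no named fact is introduced.
-/

noncomputable section

open Set Function Filter Metric Complex
open _root_.Topology
open scoped unitInterval NNReal Real

namespace Literature.Probability.RandomPlanarGeometry

namespace USTPeano

/-! ### The boundary polygon restricted to its `α`- and `β`-blocks -/

/-- A real number in `[0, m]`, `m ≥ 1`, lies in some `[j, j + 1]` with `j + 1 ≤ m`. [folklore] -/
theorem exists_nat_floor_window {m : ℕ} (hm : 1 ≤ m) {x : ℝ} (h0 : 0 ≤ x) (hx : x ≤ m) :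
    ∃ j : ℕ, j + 1 ≤ m ∧ (j : ℝ) ≤ x ∧ x ≤ j + 1 := by
  refine ⟨min ⌊x⌋₊ (m - 1), ?_, ?_, ?_⟩
  · have := min_le_right ⌊x⌋₊ (m - 1); omega
  · exact le_trans (by exact_mod_cast min_le_left _ _) (Nat.floor_le h0)
  · rcases le_or_gt ⌊x⌋₊ (m - 1) with h | h
    · rw [min_eq_left h]
      exact (Nat.lt_floor_add_one x).le
    · rw [min_eq_right h.le]
      have : ((m - 1 : ℕ) : ℝ) + 1 = m := by
        rw [Nat.cast_sub hm]; push_cast; ring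
      rw [this]; exact hx

namespace Domain

variable (Δ : Domain)

/-- The boundary vertex list is nonempty. [folklore] -/
theorem boundaryVerts_ne_nil : boundaryVerts Δ.α Δ.β Δ.a Δ.b ≠ [] := by simp [boundaryVerts]

/-- **The `α`-block of the boundary polygon is the polyline `α`**: for `s ∈ [0, 1]`,
`pathCurve α (s) = polygonLoop (boundaryVerts) ((1 + (|α| - 1) s)/N)` (the polyline of `α` occupies
the edges `1, …, |α| - 1` of the boundary cycle `a, α, b, β⁻¹`). [folklore] -/
theorem pathCurve_alpha_eq (s : I) :
    pathCurve (Δ.α.map primalPt) s = polygonLoop (boundaryVerts Δ.α Δ.β Δ.a Δ.b)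
      ((1 + ((Δ.α.length : ℝ) - 1) * s) / (boundaryVerts Δ.α Δ.β Δ.a Δ.b).length) := by
  set bv := boundaryVerts Δ.α Δ.β Δ.a Δ.b with hbv
  have hN : bv.length = Δ.α.length + Δ.β.length + 2 := by simp [hbv]
  have hnα : 1 ≤ Δ.α.length := List.length_pos_iff.2 Δ.α_ne_nil
  rw [pathCurve_apply, List.length_map]
  rcases eq_or_lt_of_le hnα with h1 | h2
  · -- `|α| = 1`: both sides are the single point `α₀`
    obtain ⟨p, hp⟩ := List.length_eq_one_iff.1 h1.symm
    have e1 : ((Δ.α.length : ℝ) - 1) = 0 := by rw [← h1]; norm_num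
    simp only [e1, zero_mul, add_zero]
    have hv := polygonLoop_vertex (l := bv) (k := 1) (by rw [hN]; omega)
    rw [Nat.cast_one] at hv
    have hα0 : 0 < Δ.α.length := by omega
    have e2 : bv[1]'(by rw [hN]; omega) = primalPt (Δ.α[0]'hα0) :=
      boundaryVerts_getElem_succ Δ.a Δ.b (i := 0) hα0
    rw [hv, e2]
    simp [hp]
  · -- `|α| ≥ 2`: locate the edge
    set x : ℝ := ((Δ.α.length : ℝ) - 1) * s with hx
    have hm1 : (1 : ℝ) ≤ (Δ.α.length : ℝ) - 1 := by
      have : (2 : ℝ) ≤ Δ.α.length := by exact_mod_cast h2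
      linarith
    have hx0 : 0 ≤ x := mul_nonneg (by linarith) s.2.1
    have hxm : x ≤ ((Δ.α.length - 1 : ℕ) : ℝ) := by
      rw [Nat.cast_sub hnα, Nat.cast_one, hx]
      exact mul_le_of_le_one_right (by linarith) s.2.2
    obtain ⟨j, hj, hjx, hxj⟩ := exists_nat_floor_window (m := Δ.α.length - 1) (by omega) hx0 hxm
    have hjα : j + 1 < Δ.α.length := by omega
    rw [affineInterp_eq_lineMap _ j (by simpa using hjα) ⟨hjx, hxj⟩]
    have hk : 1 + j < bv.length := by rw [hN]; omega
    have key := polygonLoop_apply_div (l := bv) (k := 1 + j) hk (θ := x - j)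
      ⟨by linarith, by linarith⟩
    have e : ((((1 + j : ℕ) : ℝ)) + (x - j)) / bv.length = (1 + x) / bv.length := by
      push_cast; ring
    rw [e] at key
    rw [key]
    have hmod : (1 + j + 1) % bv.length = j + 1 + 1 := by
      rw [Nat.mod_eq_of_lt (by rw [hN]; omega)]; ring
    have e1 : bv[1 + j] = primalPt Δ.α[j] := by
      rw [getElem_congr_idx (add_comm 1 j)]; exact boundaryVerts_getElem_succ Δ.a Δ.b (by omega)
    have e2 : bv[(1 + j + 1) % bv.length]'(Nat.mod_lt _ (by rw [hN]; omega)) =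
        primalPt Δ.α[j + 1] := by
      rw [getElem_congr_idx hmod]; exact boundaryVerts_getElem_succ Δ.a Δ.b hjα
    rw [e1, e2]
    simp

/-- **The `β`-block of the boundary polygon is the polyline `β` traversed backwards**: for
`s ∈ [0, 1]`, `pathCurve β (s) = polygonLoop (boundaryVerts) ((|α| + 2 + (|β| - 1)(1 - s))/N)`.
[folklore] -/
theorem pathCurve_beta_eq (s : I) :
    pathCurve (Δ.β.map dualPt) s = polygonLoop (boundaryVerts Δ.α Δ.β Δ.a Δ.b)
      ((Δ.α.length + 2 + ((Δ.β.length : ℝ) - 1) * (1 - s)) /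
        (boundaryVerts Δ.α Δ.β Δ.a Δ.b).length) := by
  set bv := boundaryVerts Δ.α Δ.β Δ.a Δ.b with hbv
  have hN : bv.length = Δ.α.length + Δ.β.length + 2 := by simp [hbv]
  have hnβ : 1 ≤ Δ.β.length := List.length_pos_iff.2 Δ.β_ne_nil
  rw [pathCurve_apply, List.length_map]
  rcases eq_or_lt_of_le hnβ with h1 | h2
  · obtain ⟨p, hp⟩ := List.length_eq_one_iff.1 h1.symm
    have e1 : ((Δ.β.length : ℝ) - 1) = 0 := by rw [← h1]; norm_num
    simp only [e1, zero_mul, add_zero]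
    have hv := polygonLoop_vertex (l := bv) (k := Δ.α.length + 2) (by rw [hN]; omega)
    push_cast at hv
    rw [hv]
    have hβ0 : 0 < Δ.β.length := by omega
    have e2 : bv[Δ.α.length + 2]'(by rw [hN]; omega) = dualPt (Δ.β[0]'hβ0) := by
      rw [getElem_congr_idx (show Δ.α.length + 2 = Δ.α.length + Δ.β.length + 1 - 0 by omega)]
      exact boundaryVerts_getElem_β Δ.a Δ.b (by omega)
    rw [e2]
    simp [hp]
  · set y : ℝ := ((Δ.β.length : ℝ) - 1) * s with hy
    have hm1 : (1 : ℝ) ≤ (Δ.β.length : ℝ) - 1 := by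
      have : (2 : ℝ) ≤ Δ.β.length := by exact_mod_cast h2
      linarith
    have hy0 : 0 ≤ y := mul_nonneg (by linarith) s.2.1
    have hym : y ≤ ((Δ.β.length - 1 : ℕ) : ℝ) := by
      rw [Nat.cast_sub hnβ, Nat.cast_one, hy]
      exact mul_le_of_le_one_right (by linarith) s.2.2
    obtain ⟨j, hj, hjy, hyj⟩ := exists_nat_floor_window (m := Δ.β.length - 1) (by omega) hy0 hym
    have hjβ : j + 1 < Δ.β.length := by omega
    rw [affineInterp_eq_lineMap _ j (by simpa using hjβ) ⟨hjy, hyj⟩]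
    -- the edge `k = |α| + |β| - j` of the cycle, traversed with parameter `1 - (y - j)`
    set k : ℕ := Δ.α.length + Δ.β.length - j with hk
    have hkN : k < bv.length := by rw [hN]; omega
    have key := polygonLoop_apply_div (l := bv) (k := k) hkN (θ := 1 - (y - j))
      ⟨by linarith, by linarith⟩
    have e : ((k : ℝ) + (1 - (y - j))) / bv.length =
        (Δ.α.length + 2 + ((Δ.β.length : ℝ) - 1) * (1 - s)) / bv.length := by
      congr 1
      rw [hk, Nat.cast_sub (by omega), hy]; push_cast; ring
    rw [e] at key
    rw [key]
    have hmod : (k + 1) % bv.length = Δ.α.length + Δ.β.length + 1 - j := by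
      rw [Nat.mod_eq_of_lt (by rw [hN]; omega)]; omega
    have e1 : bv[k] = dualPt Δ.β[j + 1] := by
      rw [getElem_congr_idx (show k = Δ.α.length + Δ.β.length + 1 - (j + 1) by omega)]
      exact boundaryVerts_getElem_β Δ.a Δ.b hjβ
    have e2 : bv[(k + 1) % bv.length]'(Nat.mod_lt _ (by rw [hN]; omega)) = dualPt Δ.β[j] := by
      rw [getElem_congr_idx hmod]; exact boundaryVerts_getElem_β Δ.a Δ.b (by omega)
    rw [e1, e2, AffineMap.lineMap_apply_one_sub]
    simp

/-- A point of the `k`-th edge of the boundary polygon is within distance `1` of the vertex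
`v_k = polygonLoop (k/N)`. [folklore] -/
theorem dist_polygonLoop_edge_le {k : ℕ} (hk : k < (boundaryVerts Δ.α Δ.β Δ.a Δ.b).length)
    {θ : ℝ} (hθ : θ ∈ Icc (0 : ℝ) 1) :
    dist (polygonLoop (boundaryVerts Δ.α Δ.β Δ.a Δ.b)
        ((k + θ) / (boundaryVerts Δ.α Δ.β Δ.a Δ.b).length))
      (polygonLoop (boundaryVerts Δ.α Δ.β Δ.a Δ.b) (k / (boundaryVerts Δ.α Δ.β Δ.a Δ.b).length))
        ≤ 1 := by
  rw [polygonLoop_apply_div hk hθ, polygonLoop_vertex hk, dist_lineMap_left, Real.norm_of_nonneg hθ.1,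
    dist_comm, dist_eq_norm]
  exact (mul_le_of_le_one_left (norm_nonneg _) hθ.2).trans (Δ.norm_sub_boundaryVerts_le_one k hk)

end Domain

/-! ### Windows and their unit profiles -/

/-- Clamping a real number to the window `[lo, hi]`. [folklore] -/
def clamp (lo hi t : ℝ) : ℝ := max lo (min t hi)

section Clamp

variable {lo hi t : ℝ}

/-- Before the window the clamp is `lo`. [folklore] -/
theorem clamp_of_le_lo (h : t ≤ lo) : clamp lo hi t = lo := by
  unfold clamp
  rw [max_eq_left]
  exact (min_le_left _ _).trans h

/-- After the window the clamp is `hi`. [folklore] -/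
theorem clamp_of_hi_le (hlh : lo ≤ hi) (h : hi ≤ t) : clamp lo hi t = hi := by
  unfold clamp
  rw [min_eq_right h, max_eq_right hlh]

/-- Inside the window the clamp is the identity. [folklore] -/
theorem clamp_of_mem (h : t ∈ Icc lo hi) : clamp lo hi t = t := by
  unfold clamp
  rw [min_eq_left h.2, max_eq_right h.1]

/-- The clamp takes values in the window. [folklore] -/
theorem clamp_mem (hlh : lo ≤ hi) (t : ℝ) : clamp lo hi t ∈ Icc lo hi :=
  ⟨le_max_left _ _, max_le hlh (min_le_right _ _)⟩

/-- The clamp is continuous. [folklore] -/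
theorem continuous_clamp (lo hi : ℝ) : Continuous (clamp lo hi) :=
  continuous_const.max (continuous_id.min continuous_const)

/-- The clamp is monotone. [folklore] -/
theorem monotone_clamp (lo hi : ℝ) : Monotone (clamp lo hi) := fun _ _ h ↦
  max_le_max le_rfl (min_le_min h le_rfl)

end Clamp

/-- The **unit profile** of the window `[lo, hi]`: `0` before `lo`, increasing affinely from `0`
to `1` across the window, `1` after `hi`. [folklore] -/
def unitProfile (lo hi t : ℝ) : ℝ := (clamp lo hi t - lo) / (hi - lo)

section Profile

variable {lo hi t : ℝ}

/-- Inside the window the profile is affine. [folklore] -/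
theorem unitProfile_of_mem (h : t ∈ Icc lo hi) : unitProfile lo hi t = (t - lo) / (hi - lo) := by
  rw [unitProfile, clamp_of_mem h]

/-- Before the window the profile vanishes. [folklore] -/
theorem unitProfile_of_le_lo (h : t ≤ lo) : unitProfile lo hi t = 0 := by
  rw [unitProfile, clamp_of_le_lo h, sub_self, zero_div]

/-- After the window the profile is `1`. [folklore] -/
theorem unitProfile_of_hi_le (hlh : lo < hi) (h : hi ≤ t) : unitProfile lo hi t = 1 := by
  rw [unitProfile, clamp_of_hi_le hlh.le h, div_self (sub_pos.2 hlh).ne']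

/-- At the left end the profile is `0`. [folklore] -/
theorem unitProfile_lo : unitProfile lo hi lo = 0 := unitProfile_of_le_lo le_rfl

/-- At the right end the profile is `1`. [folklore] -/
theorem unitProfile_hi (hlh : lo < hi) : unitProfile lo hi hi = 1 := unitProfile_of_hi_le hlh le_rfl

/-- The profile takes values in `[0, 1]`. [folklore] -/
theorem unitProfile_mem (hlh : lo < hi) (t : ℝ) : unitProfile lo hi t ∈ Icc (0 : ℝ) 1 := by
  have hc := clamp_mem hlh.le t
  have hpos : 0 < hi - lo := sub_pos.2 hlh
  refine ⟨div_nonneg (sub_nonneg.2 hc.1) hpos.le, ?_⟩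
  rw [unitProfile, div_le_one hpos]
  linarith [hc.2]

/-- The profile is continuous. [folklore] -/
theorem continuous_unitProfile (lo hi : ℝ) : Continuous (unitProfile lo hi) :=
  ((continuous_clamp lo hi).sub continuous_const).div_const _

/-- The profile is monotone. [folklore] -/
theorem monotone_unitProfile (hlh : lo < hi) : Monotone (unitProfile lo hi) := fun _ _ h ↦
  div_le_div_of_nonneg_right (sub_le_sub_right (monotone_clamp lo hi h) _) (sub_pos.2 hlh).le

/-- The profile is strictly increasing across the window. [folklore] -/
theorem strictMonoOn_unitProfile (hlh : lo < hi) : StrictMonoOn (unitProfile lo hi) (Icc lo hi) := by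
  intro x hx y hy hxy
  rw [unitProfile_of_mem hx, unitProfile_of_mem hy]
  exact div_lt_div_of_pos_right (by linarith) (sub_pos.2 hlh)

/-- The profile as a point of the unit interval. [folklore] -/
def unitProfileI (lo hi t : ℝ) : I := projIcc 0 1 zero_le_one (unitProfile lo hi t)

/-- Its value is the profile. [folklore] -/
theorem coe_unitProfileI (hlh : lo < hi) (t : ℝ) : (unitProfileI lo hi t : ℝ) = unitProfile lo hi t := by
  rw [unitProfileI, projIcc_of_mem _ (unitProfile_mem hlh t)]

/-- `unitProfileI` is continuous. [folklore] -/
theorem continuous_unitProfileI (lo hi : ℝ) : Continuous (unitProfileI lo hi) :=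
  continuous_projIcc.comp (continuous_unitProfile lo hi)

/-- `unitProfileI` is monotone. [folklore] -/
theorem monotone_unitProfileI (hlh : lo < hi) : Monotone (unitProfileI lo hi) :=
  (monotone_projIcc _).comp (monotone_unitProfile hlh)

/-- Before the window `unitProfileI = 0`. [folklore] -/
theorem unitProfileI_of_le_lo (hlh : lo < hi) (h : t ≤ lo) : unitProfileI lo hi t = 0 := by
  apply Subtype.ext
  rw [coe_unitProfileI hlh, unitProfile_of_le_lo h]
  rfl

/-- After the window `unitProfileI = 1`. [folklore] -/
theorem unitProfileI_of_hi_le (hlh : lo < hi) (h : hi ≤ t) : unitProfileI lo hi t = 1 := by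
  apply Subtype.ext
  rw [coe_unitProfileI hlh, unitProfile_of_hi_le hlh h]
  rfl

end Profile

/-! ### Gluing data and the glued parameter change -/

/-- **Gluing data** for re-timing the boundary polygon `a, α, b, β⁻¹` of a lattice domain along a
loop with two marked parameters `m₀ < m₁ < m₀ + 1` (the marks of `a` and `b`): a junction width
`τ > 0` with `2τ < m₁ - m₀`, `2τ < m₀ + 1 - m₁`, and the two increasing reparametrisations
`φ_α`, `φ_β` of `[0, 1]` matching the polylines `α`, `β` with the two boundary arcs ([LSW04]
§3.4, §4.3: `ρ(α^R, Rα_D) ≤ C`, `ρ(β^R, Rβ_D) ≤ C`). [cite: LawlerSchrammWerner2004, §4.3] -/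
structure GlueData where
  /-- the parameter of `a` on the limit loop -/
  m0 : ℝ
  /-- the parameter of `b` on the limit loop -/
  m1 : ℝ
  /-- the width of the four junction windows -/
  τ : ℝ
  /-- the reparametrisation matching the polyline `α` with the arc `α_D` -/
  φa : I ≃o I
  /-- the reparametrisation matching the polyline `β` with the arc `β_D` -/
  φb : I ≃o I
  τ_pos : 0 < τ
  lt₁ : m0 + τ < m1 - τ
  lt₂ : m1 + τ < m0 + 1 - τ

namespace GlueData

variable (g : GlueData)

/-- Breakpoints `0 < 1` of the six windows. [folklore] -/
theorem b01 : g.m0 < g.m0 + g.τ := by linarith [g.τ_pos]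

/-- Breakpoints `1 < 2` of the six windows. [folklore] -/
theorem b12 : g.m0 + g.τ < g.m1 - g.τ := g.lt₁

/-- Breakpoints `2 < 3` of the six windows. [folklore] -/
theorem b23 : g.m1 - g.τ < g.m1 := by linarith [g.τ_pos]

/-- Breakpoints `3 < 4` of the six windows. [folklore] -/
theorem b34 : g.m1 < g.m1 + g.τ := by linarith [g.τ_pos]

/-- Breakpoints `4 < 5` of the six windows. [folklore] -/
theorem b45 : g.m1 + g.τ < g.m0 + 1 - g.τ := g.lt₂

/-- Breakpoints `5 < 6` of the six windows. [folklore] -/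
theorem b56 : g.m0 + 1 - g.τ < g.m0 + 1 := by linarith [g.τ_pos]

/-- The marks are ordered. [folklore] -/
theorem m0_lt_m1 : g.m0 < g.m1 := by linarith [g.b01, g.b12, g.b23]

/-- The second mark precedes the first mark of the next period. [folklore] -/
theorem m1_lt : g.m1 < g.m0 + 1 := by linarith [g.b34, g.b45, g.b56]

end GlueData

namespace Domain

variable (Δ : Domain) (g : GlueData)

/-- The six summands of the glued parameter change (in units of `1/N`): junction window at `a`,
the `α`-block re-timed by `φ_α⁻¹`, junction windows before and after `b`, the `β`-block re-timed
by `φ_β⁻¹` (traversed backwards), junction window before `a + 1`. [folklore] -/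
def glueSum (t : ℝ) : ℝ :=
  unitProfile g.m0 (g.m0 + g.τ) t
    + ((Δ.α.length : ℝ) - 1) * (g.φa.symm (unitProfileI (g.m0 + g.τ) (g.m1 - g.τ) t) : ℝ)
    + unitProfile (g.m1 - g.τ) g.m1 t
    + unitProfile g.m1 (g.m1 + g.τ) t
    + ((Δ.β.length : ℝ) - 1) *
        (1 - (g.φb.symm (σ (unitProfileI (g.m1 + g.τ) (g.m0 + 1 - g.τ) t)) : ℝ))
    + unitProfile (g.m0 + 1 - g.τ) (g.m0 + 1) t

/-- **The glued parameter change** `κ : [m₀, m₀ + 1] → [0, 1]` from the limit-loop time to the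
polygon time: `glueSum / N`. [folklore] -/
def glueParam (t : ℝ) : ℝ := Δ.glueSum g t / (boundaryVerts Δ.α Δ.β Δ.a Δ.b).length

/-- The glued sum is continuous. [folklore] -/
theorem continuous_glueSum : Continuous (Δ.glueSum g) := by
  unfold glueSum
  have h1 : Continuous fun t ↦ (g.φa.symm (unitProfileI (g.m0 + g.τ) (g.m1 - g.τ) t) : ℝ) :=
    continuous_subtype_val.comp (g.φa.symm.continuous.comp (continuous_unitProfileI _ _))
  have h2 : Continuous fun t ↦
      (g.φb.symm (σ (unitProfileI (g.m1 + g.τ) (g.m0 + 1 - g.τ) t)) : ℝ) :=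
    continuous_subtype_val.comp (g.φb.symm.continuous.comp
      (unitInterval.continuous_symm.comp (continuous_unitProfileI _ _)))
  have := continuous_unitProfile
  fun_prop

/-- The glued parameter change is continuous. [folklore] -/
theorem continuous_glueParam : Continuous (Δ.glueParam g) :=
  (Δ.continuous_glueSum g).div_const _

/-- The glued sum is monotone. [folklore] -/
theorem monotone_glueSum : Monotone (Δ.glueSum g) := by
  have hα : 0 ≤ (Δ.α.length : ℝ) - 1 := by
    have : (1 : ℝ) ≤ Δ.α.length := by exact_mod_cast List.length_pos_iff.2 Δ.α_ne_nil
    linarith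
  have hβ : 0 ≤ (Δ.β.length : ℝ) - 1 := by
    have : (1 : ℝ) ≤ Δ.β.length := by exact_mod_cast List.length_pos_iff.2 Δ.β_ne_nil
    linarith
  have h1 : Monotone fun t ↦ (g.φa.symm (unitProfileI (g.m0 + g.τ) (g.m1 - g.τ) t) : ℝ) :=
    fun x y h ↦ Subtype.coe_le_coe.2 (g.φa.symm.monotone (monotone_unitProfileI g.b12 h))
  have h2 : Monotone fun t ↦
      1 - (g.φb.symm (σ (unitProfileI (g.m1 + g.τ) (g.m0 + 1 - g.τ) t)) : ℝ) := by
    intro x y h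
    have : g.φb.symm (σ (unitProfileI (g.m1 + g.τ) (g.m0 + 1 - g.τ) y)) ≤
        g.φb.symm (σ (unitProfileI (g.m1 + g.τ) (g.m0 + 1 - g.τ) x)) :=
      g.φb.symm.monotone (unitInterval.symm_le_symm.2 (monotone_unitProfileI g.b45 h))
    have := Subtype.coe_le_coe.2 this
    linarith
  unfold glueSum
  exact ((((((monotone_unitProfile g.b01).add (h1.const_mul hα)).add
    (monotone_unitProfile g.b23)).add (monotone_unitProfile g.b34)).add (h2.const_mul hβ)).add
    (monotone_unitProfile g.b56))

/-- The glued parameter change is monotone. [folklore] -/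
theorem monotone_glueParam : Monotone (Δ.glueParam g) := fun _ _ h ↦
  div_le_div_of_nonneg_right (Δ.monotone_glueSum g h) (Nat.cast_nonneg _)

/-! ### Values of the glued sum on the six windows -/

section Values

variable {Δ g} {t : ℝ}

/-- An increasing self-map of `[0, 1]` fixes `0`. [folklore] -/
theorem orderIso_apply_zero (φ : I ≃o I) : φ 0 = 0 := φ.map_bot

/-- An increasing self-map of `[0, 1]` fixes `1`. [folklore] -/
theorem orderIso_apply_one (φ : I ≃o I) : φ 1 = 1 := φ.map_top

/-- Window 0 (`[m₀, m₀ + τ]`, the junction edge `a → α_a`): `glueSum = u₀ ∈ [0, 1]`. [folklore] -/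
theorem glueSum_of_mem₀ (ht : t ∈ Icc g.m0 (g.m0 + g.τ)) :
    Δ.glueSum g t = unitProfile g.m0 (g.m0 + g.τ) t := by
  have h1 : t ≤ g.m0 + g.τ := ht.2
  have h2 : t ≤ g.m1 - g.τ := h1.trans g.b12.le
  have h3 : t ≤ g.m1 := h2.trans g.b23.le
  have h4 : t ≤ g.m1 + g.τ := h3.trans g.b34.le
  have h5 : t ≤ g.m0 + 1 - g.τ := h4.trans g.b45.le
  rw [glueSum, unitProfileI_of_le_lo g.b12 h1, unitProfile_of_le_lo h2, unitProfile_of_le_lo h3,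
    unitProfileI_of_le_lo g.b45 h4, unitProfile_of_le_lo h5, orderIso_apply_zero,
    unitInterval.symm_zero, orderIso_apply_one]
  simp

/-- Window 1 (`[m₀ + τ, m₁ - τ]`, the `α`-block): `glueSum = 1 + (|α| - 1) φ_α⁻¹(u₁)`. [folklore] -/
theorem glueSum_of_mem₁ (ht : t ∈ Icc (g.m0 + g.τ) (g.m1 - g.τ)) :
    Δ.glueSum g t = 1 + ((Δ.α.length : ℝ) - 1) *
      (g.φa.symm (unitProfileI (g.m0 + g.τ) (g.m1 - g.τ) t) : ℝ) := by
  have h0 : g.m0 + g.τ ≤ t := ht.1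
  have h2 : t ≤ g.m1 - g.τ := ht.2
  have h3 : t ≤ g.m1 := h2.trans g.b23.le
  have h4 : t ≤ g.m1 + g.τ := h3.trans g.b34.le
  have h5 : t ≤ g.m0 + 1 - g.τ := h4.trans g.b45.le
  rw [glueSum, unitProfile_of_hi_le g.b01 h0, unitProfile_of_le_lo h2, unitProfile_of_le_lo h3,
    unitProfileI_of_le_lo g.b45 h4, unitProfile_of_le_lo h5, unitInterval.symm_zero,
    orderIso_apply_one]
  simp

/-- Window 2 (`[m₁ - τ, m₁]`, the junction edge `α_b → b`): `glueSum = |α| + u₂`. [folklore] -/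
theorem glueSum_of_mem₂ (ht : t ∈ Icc (g.m1 - g.τ) g.m1) :
    Δ.glueSum g t = Δ.α.length + unitProfile (g.m1 - g.τ) g.m1 t := by
  have h0 : g.m0 + g.τ ≤ t := g.b12.le.trans ht.1
  have h1 : g.m1 - g.τ ≤ t := ht.1
  have h3 : t ≤ g.m1 := ht.2
  have h4 : t ≤ g.m1 + g.τ := h3.trans g.b34.le
  have h5 : t ≤ g.m0 + 1 - g.τ := h4.trans g.b45.le
  rw [glueSum, unitProfile_of_hi_le g.b01 h0, unitProfileI_of_hi_le g.b12 h1, unitProfile_of_le_lo h3,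
    unitProfileI_of_le_lo g.b45 h4, unitProfile_of_le_lo h5, unitInterval.symm_zero,
    orderIso_apply_one, orderIso_apply_one]
  simp

/-- Window 3 (`[m₁, m₁ + τ]`, the junction edge `b → β_b`): `glueSum = |α| + 1 + u₃`. [folklore] -/
theorem glueSum_of_mem₃ (ht : t ∈ Icc g.m1 (g.m1 + g.τ)) :
    Δ.glueSum g t = Δ.α.length + 1 + unitProfile g.m1 (g.m1 + g.τ) t := by
  have h0 : g.m0 + g.τ ≤ t := g.b12.le.trans (g.b23.le.trans ht.1)
  have h1 : g.m1 - g.τ ≤ t := g.b23.le.trans ht.1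
  have h2 : g.m1 ≤ t := ht.1
  have h4 : t ≤ g.m1 + g.τ := ht.2
  have h5 : t ≤ g.m0 + 1 - g.τ := h4.trans g.b45.le
  rw [glueSum, unitProfile_of_hi_le g.b01 h0, unitProfileI_of_hi_le g.b12 h1, unitProfile_of_hi_le g.b23 h2,
    unitProfileI_of_le_lo g.b45 h4, unitProfile_of_le_lo h5, unitInterval.symm_zero,
    orderIso_apply_one, orderIso_apply_one]
  simp

/-- Window 4 (`[m₁ + τ, m₀ + 1 - τ]`, the `β`-block backwards):
`glueSum = |α| + 2 + (|β| - 1)(1 - φ_β⁻¹(1 - u₄))`. [folklore] -/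
theorem glueSum_of_mem₄ (ht : t ∈ Icc (g.m1 + g.τ) (g.m0 + 1 - g.τ)) :
    Δ.glueSum g t = Δ.α.length + 2 + ((Δ.β.length : ℝ) - 1) *
      (1 - (g.φb.symm (σ (unitProfileI (g.m1 + g.τ) (g.m0 + 1 - g.τ) t)) : ℝ)) := by
  have h0 : g.m0 + g.τ ≤ t := g.b12.le.trans (g.b23.le.trans (g.b34.le.trans ht.1))
  have h1 : g.m1 - g.τ ≤ t := g.b23.le.trans (g.b34.le.trans ht.1)
  have h2 : g.m1 ≤ t := g.b34.le.trans ht.1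
  have h3 : g.m1 + g.τ ≤ t := ht.1
  have h5 : t ≤ g.m0 + 1 - g.τ := ht.2
  rw [glueSum, unitProfile_of_hi_le g.b01 h0, unitProfileI_of_hi_le g.b12 h1, unitProfile_of_hi_le g.b23 h2,
    unitProfile_of_hi_le g.b34 h3, unitProfile_of_le_lo h5, orderIso_apply_one]
  simp only [Set.Icc.coe_one]
  ring

/-- Window 5 (`[m₀ + 1 - τ, m₀ + 1]`, the junction edge `β_a → a`): `glueSum = N - 1 + u₅`.
[folklore] -/
theorem glueSum_of_mem₅ (ht : t ∈ Icc (g.m0 + 1 - g.τ) (g.m0 + 1)) :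
    Δ.glueSum g t = Δ.α.length + Δ.β.length + 1 + unitProfile (g.m0 + 1 - g.τ) (g.m0 + 1) t := by
  have h0 : g.m0 + g.τ ≤ t := g.b12.le.trans (g.b23.le.trans (g.b34.le.trans (g.b45.le.trans ht.1)))
  have h1 : g.m1 - g.τ ≤ t := g.b23.le.trans (g.b34.le.trans (g.b45.le.trans ht.1))
  have h2 : g.m1 ≤ t := g.b34.le.trans (g.b45.le.trans ht.1)
  have h3 : g.m1 + g.τ ≤ t := g.b45.le.trans ht.1
  have h4 : g.m0 + 1 - g.τ ≤ t := ht.1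
  rw [glueSum, unitProfile_of_hi_le g.b01 h0, unitProfileI_of_hi_le g.b12 h1, unitProfile_of_hi_le g.b23 h2,
    unitProfile_of_hi_le g.b34 h3, unitProfileI_of_hi_le g.b45 h4, orderIso_apply_one,
    unitInterval.symm_one, orderIso_apply_zero]
  simp only [Set.Icc.coe_one, Set.Icc.coe_zero]
  ring

/-- At `m₀` the glued sum vanishes. [folklore] -/
theorem glueSum_m0 : Δ.glueSum g g.m0 = 0 := by
  rw [glueSum_of_mem₀ ⟨le_rfl, g.b01.le⟩, unitProfile_lo]

/-- At `m₀ + 1` the glued sum is `N`. [folklore] -/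
theorem glueSum_m0_add_one : Δ.glueSum g (g.m0 + 1) = (boundaryVerts Δ.α Δ.β Δ.a Δ.b).length := by
  rw [glueSum_of_mem₅ ⟨g.b56.le, le_rfl⟩, unitProfile_hi g.b56, length_boundaryVerts]
  push_cast
  ring

/-- At `m₀` the glued parameter change is `0`. [folklore] -/
theorem glueParam_m0 : Δ.glueParam g g.m0 = 0 := by
  rw [glueParam, glueSum_m0, zero_div]

/-- At `m₀ + 1` the glued parameter change is `1`. [folklore] -/
theorem glueParam_m0_add_one : Δ.glueParam g (g.m0 + 1) = 1 := by
  rw [glueParam, glueSum_m0_add_one, div_self]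
  have : 0 < (boundaryVerts Δ.α Δ.β Δ.a Δ.b).length := by simp
  exact_mod_cast this.ne'

/-- The glued parameter change maps `[m₀, m₀ + 1]` into `[0, 1]`. [folklore] -/
theorem glueParam_mem_Icc (ht : t ∈ Icc g.m0 (g.m0 + 1)) : Δ.glueParam g t ∈ Icc (0 : ℝ) 1 :=
  ⟨glueParam_m0 (Δ := Δ) (g := g) ▸ Δ.monotone_glueParam g ht.1,
    glueParam_m0_add_one (Δ := Δ) (g := g) ▸ Δ.monotone_glueParam g ht.2⟩

end Values

/-! ### Strict monotonicity -/

/-- **Gluing strictly increasing pieces**: six monotone functions, the `i`-th strictly increasing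
on the `i`-th of six consecutive windows, have a strictly increasing sum on the union of the
windows. [folklore] -/
theorem strictMonoOn_add_six {f₀ f₁ f₂ f₃ f₄ f₅ : ℝ → ℝ} {b₀ b₁ b₂ b₃ b₄ b₅ b₆ : ℝ}
    (h₀ : Monotone f₀) (h₁ : Monotone f₁) (h₂ : Monotone f₂) (h₃ : Monotone f₃) (h₄ : Monotone f₄)
    (h₅ : Monotone f₅) (s₀ : StrictMonoOn f₀ (Icc b₀ b₁)) (s₁ : StrictMonoOn f₁ (Icc b₁ b₂))
    (s₂ : StrictMonoOn f₂ (Icc b₂ b₃)) (s₃ : StrictMonoOn f₃ (Icc b₃ b₄))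
    (s₄ : StrictMonoOn f₄ (Icc b₄ b₅)) (s₅ : StrictMonoOn f₅ (Icc b₅ b₆))
    (l₁ : b₁ ≤ b₂) (l₂ : b₂ ≤ b₃) (l₃ : b₃ ≤ b₄) (l₄ : b₄ ≤ b₅) (l₅ : b₅ ≤ b₆) :
    StrictMonoOn (fun t ↦ f₀ t + f₁ t + f₂ t + f₃ t + f₄ t + f₅ t) (Icc b₀ b₆) := by
  intro x hx y hy hxy
  have m₀ := h₀ hxy.le; have m₁ := h₁ hxy.le; have m₂ := h₂ hxy.le
  have m₃ := h₃ hxy.le; have m₄ := h₄ hxy.le; have m₅ := h₅ hxy.le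
  -- the window containing `x` contributes a strict inequality
  have step : ∀ {f : ℝ → ℝ} {lo hi : ℝ}, Monotone f → StrictMonoOn f (Icc lo hi) → lo ≤ x → x < hi →
      hi ≤ b₆ → f x < f y := by
    intro f lo hi hf hs hlo hhi hhi6
    have hlt : x < min y hi := lt_min hxy hhi
    calc f x < f (min y hi) := hs ⟨hlo, hhi.le⟩ ⟨hlo.trans hlt.le, min_le_right _ _⟩ hlt
      _ ≤ f y := hf (min_le_left _ _)
  simp only
  rcases lt_or_ge x b₁ with c₁ | c₁
  · have := step h₀ s₀ hx.1 c₁ (by linarith); linarith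
  rcases lt_or_ge x b₂ with c₂ | c₂
  · have := step h₁ s₁ c₁ c₂ (by linarith); linarith
  rcases lt_or_ge x b₃ with c₃ | c₃
  · have := step h₂ s₂ c₂ c₃ (by linarith); linarith
  rcases lt_or_ge x b₄ with c₄ | c₄
  · have := step h₃ s₃ c₃ c₄ (by linarith); linarith
  rcases lt_or_ge x b₅ with c₅ | c₅
  · have := step h₄ s₄ c₄ c₅ (by linarith); linarith
  · have : f₅ x < f₅ y := s₅ ⟨c₅, hx.2⟩ ⟨c₅.trans hxy.le, hy.2⟩ hxy
    linarith

section Strict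

variable {Δ g}

/-- `unitProfileI` is strictly increasing across its window. [folklore] -/
theorem strictMonoOn_unitProfileI {lo hi : ℝ} (hlh : lo < hi) :
    StrictMonoOn (unitProfileI lo hi) (Icc lo hi) := fun x hx y hy hxy ↦ by
  change (unitProfileI lo hi x : ℝ) < unitProfileI lo hi y
  rw [coe_unitProfileI hlh, coe_unitProfileI hlh]
  exact strictMonoOn_unitProfile hlh hx hy hxy

/-- **The glued parameter change is strictly increasing on `[m₀, m₀ + 1]`** when `α` and `β`
have at least two points each (so that the two blocks have positive parameter length).
[folklore] -/
theorem strictMonoOn_glueSum (hα : 2 ≤ Δ.α.length) (hβ : 2 ≤ Δ.β.length) :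
    StrictMonoOn (Δ.glueSum g) (Icc g.m0 (g.m0 + 1)) := by
  have hα' : 0 < (Δ.α.length : ℝ) - 1 := by
    have : (2 : ℝ) ≤ Δ.α.length := by exact_mod_cast hα
    linarith
  have hβ' : 0 < (Δ.β.length : ℝ) - 1 := by
    have : (2 : ℝ) ≤ Δ.β.length := by exact_mod_cast hβ
    linarith
  -- the two block terms
  have h1 : Monotone fun t ↦ ((Δ.α.length : ℝ) - 1) *
      (g.φa.symm (unitProfileI (g.m0 + g.τ) (g.m1 - g.τ) t) : ℝ) :=
    fun x y h ↦ mul_le_mul_of_nonneg_left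
      (Subtype.coe_le_coe.2 (g.φa.symm.monotone (monotone_unitProfileI g.b12 h))) hα'.le
  have s1 : StrictMonoOn (fun t ↦ ((Δ.α.length : ℝ) - 1) *
      (g.φa.symm (unitProfileI (g.m0 + g.τ) (g.m1 - g.τ) t) : ℝ)) (Icc (g.m0 + g.τ) (g.m1 - g.τ)) :=
    fun x hx y hy hxy ↦ mul_lt_mul_of_pos_left
      (Subtype.coe_lt_coe.2 (g.φa.symm.strictMono (strictMonoOn_unitProfileI g.b12 hx hy hxy))) hα'
  have h4 : Monotone fun t ↦ ((Δ.β.length : ℝ) - 1) *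
      (1 - (g.φb.symm (σ (unitProfileI (g.m1 + g.τ) (g.m0 + 1 - g.τ) t)) : ℝ)) := by
    intro x y h
    have : g.φb.symm (σ (unitProfileI (g.m1 + g.τ) (g.m0 + 1 - g.τ) y)) ≤
        g.φb.symm (σ (unitProfileI (g.m1 + g.τ) (g.m0 + 1 - g.τ) x)) :=
      g.φb.symm.monotone (unitInterval.symm_le_symm.2 (monotone_unitProfileI g.b45 h))
    have := Subtype.coe_le_coe.2 this
    exact mul_le_mul_of_nonneg_left (by linarith) hβ'.le
  have s4 : StrictMonoOn (fun t ↦ ((Δ.β.length : ℝ) - 1) *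
      (1 - (g.φb.symm (σ (unitProfileI (g.m1 + g.τ) (g.m0 + 1 - g.τ) t)) : ℝ)))
      (Icc (g.m1 + g.τ) (g.m0 + 1 - g.τ)) := by
    intro x hx y hy hxy
    have : g.φb.symm (σ (unitProfileI (g.m1 + g.τ) (g.m0 + 1 - g.τ) y)) <
        g.φb.symm (σ (unitProfileI (g.m1 + g.τ) (g.m0 + 1 - g.τ) x)) :=
      g.φb.symm.strictMono (unitInterval.symm_lt_symm.2 (strictMonoOn_unitProfileI g.b45 hx hy hxy))
    have := Subtype.coe_lt_coe.2 this
    exact mul_lt_mul_of_pos_left (by linarith) hβ'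
  exact strictMonoOn_add_six (monotone_unitProfile g.b01) h1 (monotone_unitProfile g.b23)
    (monotone_unitProfile g.b34) h4 (monotone_unitProfile g.b56) (strictMonoOn_unitProfile g.b01) s1
    (strictMonoOn_unitProfile g.b23) (strictMonoOn_unitProfile g.b34) s4
    (strictMonoOn_unitProfile g.b56) g.b12.le g.b23.le g.b34.le g.b45.le g.b56.le

/-- The glued parameter change is strictly increasing on `[m₀, m₀ + 1]`. [folklore] -/
theorem strictMonoOn_glueParam (hα : 2 ≤ Δ.α.length) (hβ : 2 ≤ Δ.β.length) :
    StrictMonoOn (Δ.glueParam g) (Icc g.m0 (g.m0 + 1)) := fun x hx y hy hxy ↦ by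
  have hN : (0 : ℝ) < (boundaryVerts Δ.α Δ.β Δ.a Δ.b).length := by
    have : 0 < (boundaryVerts Δ.α Δ.β Δ.a Δ.b).length := by simp
    exact_mod_cast this
  exact div_lt_div_of_pos_right (strictMonoOn_glueSum hα hβ hx hy hxy) hN

/-- On `[m₀, m₀ + 1)` the glued parameter change takes values in `[0, 1)`. [folklore] -/
theorem glueParam_mem_Ico (hα : 2 ≤ Δ.α.length) (hβ : 2 ≤ Δ.β.length) {t : ℝ}
    (ht : t ∈ Ico g.m0 (g.m0 + 1)) : Δ.glueParam g t ∈ Ico (0 : ℝ) 1 :=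
  ⟨(glueParam_mem_Icc ⟨ht.1, ht.2.le⟩).1, glueParam_m0_add_one (Δ := Δ) (g := g) ▸
    strictMonoOn_glueParam hα hβ ⟨ht.1, ht.2.le⟩ ⟨by linarith [ht.1], le_rfl⟩ ht.2⟩

end Strict

/-! ### The glued loop -/

/-- **The re-timed boundary loop**: the boundary polygon of `D(α, β, a, b)` run through the glued
parameter change, as a `1`-periodic loop in the limit-loop time `t` (`t ↦ m₀ + fract (t - m₀)`
reduces to the fundamental window `[m₀, m₀ + 1)`). [folklore] -/
def glueLoop (t : ℝ) : ℂ :=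
  polygonLoop (boundaryVerts Δ.α Δ.β Δ.a Δ.b) (Δ.glueParam g (g.m0 + Int.fract (t - g.m0)))

/-- On the fundamental window the loop is the polygon at the glued parameter. [folklore] -/
theorem glueLoop_of_mem {t : ℝ} (ht : t ∈ Ico g.m0 (g.m0 + 1)) :
    Δ.glueLoop g t = polygonLoop (boundaryVerts Δ.α Δ.β Δ.a Δ.b) (Δ.glueParam g t) := by
  rw [glueLoop, Int.fract_eq_self.2 ⟨by linarith [ht.1], by linarith [ht.2]⟩, add_sub_cancel]

/-- The reduced time `m₀ + fract (t - m₀)` lies in the fundamental window. [folklore] -/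
theorem reduce_mem (t : ℝ) : g.m0 + Int.fract (t - g.m0) ∈ Ico g.m0 (g.m0 + 1) :=
  ⟨by linarith [Int.fract_nonneg (t - g.m0)], by linarith [Int.fract_lt_one (t - g.m0)]⟩

/-- The loop at `t` is the loop at the reduced time. [folklore] -/
theorem glueLoop_eq_reduce (t : ℝ) :
    Δ.glueLoop g t = Δ.glueLoop g (g.m0 + Int.fract (t - g.m0)) := by
  rw [Δ.glueLoop_of_mem g (reduce_mem g t)]
  rfl

/-- **The glued loop is continuous** (the polygon closes up: parameter `0` at `m₀` and `1` at
`m₀ + 1`). [folklore] -/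
theorem continuous_glueLoop : Continuous (Δ.glueLoop g) := by
  set F : ℝ → ℂ := fun u ↦ polygonLoop (boundaryVerts Δ.α Δ.β Δ.a Δ.b) (Δ.glueParam g (g.m0 + u))
  have hF : Continuous F :=
    (continuous_polygonLoop _).comp ((Δ.continuous_glueParam g).comp (continuous_const.add continuous_id))
  have h01 : F 0 = F 1 := by
    simp only [F, add_zero, glueParam_m0, glueParam_m0_add_one]
    exact ((periodic_polygonLoop _) 0).symm.trans (by rw [zero_add])
  have h : Continuous ((F ∘ Int.fract) ∘ fun t : ℝ ↦ t - g.m0) :=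
    (ContinuousOn.comp_fract'' hF.continuousOn h01).comp (continuous_id.sub continuous_const)
  exact h

/-- The glued loop is `1`-periodic. [folklore] -/
theorem periodic_glueLoop : Periodic (Δ.glueLoop g) 1 := fun t ↦ by
  simp only [glueLoop]
  rw [show t + 1 - g.m0 = (t - g.m0) + 1 by ring, Int.fract_add_one]

/-- **The glued loop traces the boundary polygon.** [folklore] -/
theorem range_glueLoop : range (Δ.glueLoop g) = frontier Δ.carrier := by
  rw [Δ.frontier_carrier]
  apply Subset.antisymm
  · rintro _ ⟨t, rfl⟩
    exact mem_range_self _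
  · rintro _ ⟨x, rfl⟩
    -- `polygonLoop x = polygonLoop (fract x)` and `fract x ∈ [0, 1) = κ [m₀, m₀ + 1)`
    have hx : Int.fract x ∈ Ico (Δ.glueParam g g.m0) (Δ.glueParam g (g.m0 + 1)) := by
      rw [glueParam_m0, glueParam_m0_add_one]
      exact ⟨Int.fract_nonneg x, Int.fract_lt_one x⟩
    obtain ⟨t, ht, htx⟩ :=
      intermediate_value_Ico (by linarith) (Δ.continuous_glueParam g).continuousOn hx
    refine ⟨t, ?_⟩
    rw [Δ.glueLoop_of_mem g ht, htx, polygonLoop_fract]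

/-- **The glued loop is injective on a period** (the boundary polygon is simple and the glued
parameter change is strictly increasing). [folklore] -/
theorem injOn_glueLoop (hα : 2 ≤ Δ.α.length) (hβ : 2 ≤ Δ.β.length) :
    InjOn (Δ.glueLoop g) (Ico 0 1) := by
  intro s hs t ht hst
  rw [Δ.glueLoop_eq_reduce g s, Δ.glueLoop_eq_reduce g t, Δ.glueLoop_of_mem g (reduce_mem g s),
    Δ.glueLoop_of_mem g (reduce_mem g t)] at hst
  have h1 := injOn_polygonLoop Δ.simple (glueParam_mem_Ico hα hβ (reduce_mem g s))
    (glueParam_mem_Ico hα hβ (reduce_mem g t)) hst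
  have h2 := (strictMonoOn_glueParam hα hβ).injOn ⟨(reduce_mem g s).1, (reduce_mem g s).2.le⟩
    ⟨(reduce_mem g t).1, (reduce_mem g t).2.le⟩ h1
  have h3 : Int.fract (s - g.m0) = Int.fract (t - g.m0) := by linarith
  rw [Int.fract_eq_fract] at h3
  obtain ⟨z, hz⟩ := h3
  have hz' : s - t = z := by linarith
  have hz0 : (z : ℝ) = 0 := by
    have h1 : (-1 : ℝ) < z := by rw [← hz']; linarith [hs.1, ht.2]
    have h2 : (z : ℝ) < 1 := by rw [← hz']; linarith [hs.2, ht.1]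
    have : z = 0 := by
      have h1' : (-1 : ℤ) < z := by exact_mod_cast h1
      have h2' : z < 1 := by exact_mod_cast h2
      omega
    simp [this]
  linarith

end Domain

/-! ### The rescaled approximation as a Jordan domain -/

namespace Domain

variable (Δ : Domain) (g : GlueData)

/-- **The rescaled lattice domain `R⁻¹ D(α, β, a, b)` as a Jordan domain with the re-timed
boundary loop** `t ↦ R⁻¹ · glueLoop t`. [cite: LawlerSchrammWerner2004, §4.3] -/
def approxJordan (hα : 2 ≤ Δ.α.length) (hβ : 2 ≤ Δ.β.length) {R : ℝ} (hR : 0 < R) : JordanDomain where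
  carrier := (fun z : ℂ ↦ ((R : ℂ))⁻¹ * z) '' Δ.carrier
  boundary t := ((R : ℂ))⁻¹ * Δ.glueLoop g t
  isOpen := (Homeomorph.mulLeft₀ ((R : ℂ))⁻¹ (inv_ne_zero (by exact_mod_cast hR.ne'))).isOpenMap _
    Δ.isOpen_carrier
  isBounded := by
    obtain ⟨C, hC⟩ := Δ.isBounded_carrier.exists_norm_le
    refine isBounded_iff_forall_norm_le.2 ⟨R⁻¹ * C, ?_⟩
    rintro _ ⟨z, hz, rfl⟩
    rw [norm_mul, norm_inv, Complex.norm_real, Real.norm_of_nonneg hR.le]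
    exact mul_le_mul_of_nonneg_left (hC z hz) (inv_nonneg.2 hR.le)
  isConnected := Δ.isConnected_carrier.image _ (continuous_const.mul continuous_id).continuousOn
  continuous_boundary := continuous_const.mul (Δ.continuous_glueLoop g)
  periodic_boundary t := by simp only [Δ.periodic_glueLoop g t]
  injOn_boundary s hs t ht hst := Δ.injOn_glueLoop g hα hβ hs ht
    (mul_left_cancel₀ (inv_ne_zero (by exact_mod_cast hR.ne')) hst)
  range_boundary := by
    have hc : ((R : ℂ))⁻¹ ≠ 0 := inv_ne_zero (by exact_mod_cast hR.ne')
    rw [show (fun t ↦ ((R : ℂ))⁻¹ * Δ.glueLoop g t) = (fun z ↦ ((R : ℂ))⁻¹ * z) ∘ Δ.glueLoop g from rfl,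
      range_comp, Δ.range_glueLoop g]
    exact (Homeomorph.mulLeft₀ ((R : ℂ))⁻¹ hc).image_frontier Δ.carrier

/-- The carrier of the rescaled domain. [folklore] -/
@[simp] theorem approxJordan_carrier (hα : 2 ≤ Δ.α.length) (hβ : 2 ≤ Δ.β.length) {R : ℝ} (hR : 0 < R) :
    (Δ.approxJordan g hα hβ hR).carrier = (fun z : ℂ ↦ ((R : ℂ))⁻¹ * z) '' Δ.carrier := rfl

/-- The boundary loop of the rescaled domain. [folklore] -/
@[simp] theorem approxJordan_boundary (hα : 2 ≤ Δ.α.length) (hβ : 2 ≤ Δ.β.length) {R : ℝ} (hR : 0 < R)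
    (t : ℝ) : (Δ.approxJordan g hα hβ hR).boundary t = ((R : ℂ))⁻¹ * Δ.glueLoop g t := rfl

/-- `0` lies in the rescaled domain when it lies in the domain. [folklore] -/
theorem zero_mem_approxJordan (hα : 2 ≤ Δ.α.length) (hβ : 2 ≤ Δ.β.length) {R : ℝ} (hR : 0 < R)
    (h0 : (0 : ℂ) ∈ Δ.carrier) : (0 : ℂ) ∈ (Δ.approxJordan g hα hβ hR).carrier :=
  ⟨0, h0, by simp⟩

end Domain

/-! ### The estimate: the re-timed polygon stays within `13` of `R · J` -/

/-- **Gluing data adapted to an approximation** `D^R` of the smooth domain `D` at scale `R`: the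
marks are those of `a`, `b` on the boundary loop `J` of `D`; `φ_α`, `φ_β` realise
`ρ(α^R, Rα_D) < 11`, `ρ(β^R, Rβ_D) < 11` pointwise ([LSW04] §4.3 with `C = 10`); and `J` moves by
at most `R⁻¹` over parameter distances `≤ τ` on the fundamental window. [cite: LawlerSchrammWerner2004, §4.3] -/
structure GlueData.Adapted (g : GlueData) (D : SmoothDomain) (R : ℝ) (Δ : Domain) : Prop where
  m0_eq : g.m0 = D.toMarkedDomain.mark 0
  m1_eq : g.m1 = D.toMarkedDomain.mark 1
  distα : ∀ s : I, dist (pathCurve (Δ.α.map primalPt) s) (R * D.arcA (g.φa s)) < 11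
  distβ : ∀ s : I, dist (pathCurve (Δ.β.map dualPt) s) (R * D.arcB (g.φb s)) < 11
  cont : ∀ t ∈ Icc g.m0 (g.m0 + 1), ∀ t' ∈ Icc g.m0 (g.m0 + 1), |t - t'| ≤ g.τ →
    dist (D.toMarkedDomain.boundary t) (D.toMarkedDomain.boundary t') ≤ R⁻¹

namespace Domain

variable (Δ : Domain) (g : GlueData)

/-- `α₀` is the vertex `1` of the boundary cycle, as a value of the polyline `α`. [folklore] -/
theorem pathCurve_alpha_zero :
    pathCurve (Δ.α.map primalPt) 0 = (boundaryVerts Δ.α Δ.β Δ.a Δ.b)[1]'(by simp) := by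
  rw [Δ.pathCurve_alpha_eq 0, ← polygonLoop_vertex (l := boundaryVerts Δ.α Δ.β Δ.a Δ.b) (k := 1) (by simp)]
  simp

/-- `α_b` is the vertex `|α|` of the boundary cycle, as a value of the polyline `α`. [folklore] -/
theorem pathCurve_alpha_one :
    pathCurve (Δ.α.map primalPt) 1 = (boundaryVerts Δ.α Δ.β Δ.a Δ.b)[Δ.α.length]'(by simp; omega) := by
  rw [Δ.pathCurve_alpha_eq 1, ← polygonLoop_vertex (l := boundaryVerts Δ.α Δ.β Δ.a Δ.b)
    (k := Δ.α.length) (by simp; omega)]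
  simp

/-- `β_b` is the vertex `|α| + 2` of the boundary cycle, as a value of the polyline `β`. [folklore] -/
theorem pathCurve_beta_one :
    pathCurve (Δ.β.map dualPt) 1 =
      (boundaryVerts Δ.α Δ.β Δ.a Δ.b)[Δ.α.length + 2]'(by simp; have := List.length_pos_iff.2 Δ.β_ne_nil; omega) := by
  rw [Δ.pathCurve_beta_eq 1, ← polygonLoop_vertex (l := boundaryVerts Δ.α Δ.β Δ.a Δ.b)
    (k := Δ.α.length + 2) (by simp; have := List.length_pos_iff.2 Δ.β_ne_nil; omega)]
  simp

/-- `β_a` is the last vertex of the boundary cycle, as a value of the polyline `β`. [folklore] -/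
theorem pathCurve_beta_zero :
    pathCurve (Δ.β.map dualPt) 0 =
      (boundaryVerts Δ.α Δ.β Δ.a Δ.b)[Δ.α.length + Δ.β.length + 1]'(by simp) := by
  rw [Δ.pathCurve_beta_eq 0, ← polygonLoop_vertex (l := boundaryVerts Δ.α Δ.β Δ.a Δ.b)
    (k := Δ.α.length + Δ.β.length + 1) (by simp)]
  congr 1
  simp only [Set.Icc.coe_zero, sub_zero, mul_one, length_boundaryVerts]
  push_cast
  ring

/-- A point of the `k`-th edge of the boundary polygon is within distance `1` of the vertex
`v_{k+1}`. [folklore] -/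
theorem dist_polygonLoop_edge_le' {k : ℕ} (hk : k < (boundaryVerts Δ.α Δ.β Δ.a Δ.b).length)
    {θ : ℝ} (hθ : θ ∈ Icc (0 : ℝ) 1) :
    dist (polygonLoop (boundaryVerts Δ.α Δ.β Δ.a Δ.b)
        ((k + θ) / (boundaryVerts Δ.α Δ.β Δ.a Δ.b).length))
      ((boundaryVerts Δ.α Δ.β Δ.a Δ.b)[(k + 1) % (boundaryVerts Δ.α Δ.β Δ.a Δ.b).length]'
        (Nat.mod_lt _ (by simp))) ≤ 1 := by
  rw [polygonLoop_apply_div hk hθ, dist_lineMap_right, Real.norm_of_nonneg (by linarith [hθ.2]),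
    dist_eq_norm, ← norm_neg, neg_sub]
  exact (mul_le_of_le_one_left (norm_nonneg _) (by linarith [hθ.1])).trans
    (Δ.norm_sub_boundaryVerts_le_one k hk)

section Estimate

variable {Δ g} {D : SmoothDomain} {R : ℝ}

/-- Rescaled comparison of two values of the limit loop: `dist (R J t₀) (R J t) ≤ 1` when
`|t₀ - t| ≤ τ` on the fundamental window. [folklore] -/
theorem dist_mul_boundary_le (hR : 0 < R) (h : g.Adapted D R Δ) {t₀ t : ℝ}
    (ht₀ : t₀ ∈ Icc g.m0 (g.m0 + 1)) (ht : t ∈ Icc g.m0 (g.m0 + 1)) (hd : |t₀ - t| ≤ g.τ) :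
    dist ((R : ℂ) * D.toMarkedDomain.boundary t₀) (R * D.toMarkedDomain.boundary t) ≤ 1 := by
  rw [dist_eq_norm, ← mul_sub, norm_mul, Complex.norm_real, Real.norm_of_nonneg hR.le, ← dist_eq_norm]
  calc R * dist (D.toMarkedDomain.boundary t₀) (D.toMarkedDomain.boundary t)
      ≤ R * R⁻¹ := mul_le_mul_of_nonneg_left (h.cont t₀ ht₀ t ht hd) hR.le
    _ = 1 := mul_inv_cancel₀ hR.ne'

/-- The affine window parameter moves points by at most `τ`: if `σ = (t - lo)/(hi - lo)` on the
window `[lo, hi] = [p + τ, q - τ]` then `|p + σ (q - p) - t| ≤ τ`. [folklore] -/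
theorem abs_affine_sub_le {p q τ t : ℝ} (hτ : 0 < τ) (hpq : p + τ < q - τ) (ht : t ∈ Icc (p + τ) (q - τ)) :
    |p + unitProfile (p + τ) (q - τ) t * (q - p) - t| ≤ τ := by
  have hL : 0 < q - τ - (p + τ) := by linarith
  have hσ := unitProfile_mem hpq t
  set σ' := unitProfile (p + τ) (q - τ) t with hσ'
  have hσL : σ' * (q - τ - (p + τ)) = t - (p + τ) := by
    rw [hσ', unitProfile_of_mem ht, div_mul_cancel₀ _ hL.ne']
  have key : p + σ' * (q - p) - t = 2 * τ * σ' - τ := by linear_combination hσL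
  rw [key, abs_le]
  constructor <;> nlinarith [hσ.1, hσ.2]

/-- **The re-timed boundary polygon stays within distance `13` of `R · J`** on the fundamental
window. Window by window: on a junction window the polygon point is within `1` of `α_a`, `α_b`,
`β_b` or `β_a`, which is within `11` of `R · a` or `R · b`, which is within `1` of `R · J(t)`; on a
block the polygon point IS the matched polyline point, within `11` of `R · J` at a parameter within
`τ` of `t`, hence within `12` of `R · J(t)`. [cite: LawlerSchrammWerner2004, §4.3] -/
theorem norm_glueLoop_sub_le_of_mem (hR : 0 < R) (h : g.Adapted D R Δ) {t : ℝ}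
    (ht : t ∈ Ico g.m0 (g.m0 + 1)) :
    ‖Δ.glueLoop g t - R * D.toMarkedDomain.boundary t‖ ≤ 13 := by
  set bv := boundaryVerts Δ.α Δ.β Δ.a Δ.b with hbv
  set J := D.toMarkedDomain.boundary with hJ
  have hN0 : 0 < bv.length := by simp [hbv]
  have hN : (0 : ℝ) < bv.length := by exact_mod_cast hN0
  have hNeq : (bv.length : ℝ) = Δ.α.length + Δ.β.length + 2 := by
    rw [hbv, length_boundaryVerts]; push_cast; ring
  have hnα : 1 ≤ Δ.α.length := List.length_pos_iff.2 Δ.α_ne_nil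
  have hnβ : 1 ≤ Δ.β.length := List.length_pos_iff.2 Δ.β_ne_nil
  have htI : t ∈ Icc g.m0 (g.m0 + 1) := ⟨ht.1, ht.2.le⟩
  have hm0I : g.m0 ∈ Icc g.m0 (g.m0 + 1) := ⟨le_rfl, by linarith⟩
  have hm1I : g.m1 ∈ Icc g.m0 (g.m0 + 1) := ⟨g.m0_lt_m1.le, g.m1_lt.le⟩
  have hm01I : g.m0 + 1 ∈ Icc g.m0 (g.m0 + 1) := ⟨by linarith, le_rfl⟩
  have hA0 : D.arcA 0 = J g.m0 := by rw [D.arcA_zero, h.m0_eq]; rfl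
  have hA1 : D.arcA 1 = J g.m1 := by rw [D.arcA_one, h.m1_eq]; rfl
  have hB0 : D.arcB 0 = J g.m0 := by rw [D.arcB_zero, h.m0_eq]; rfl
  have hB1 : D.arcB 1 = J g.m1 := by rw [D.arcB_one, h.m1_eq]; rfl
  have eL : Δ.glueLoop g t = polygonLoop bv (Δ.glueSum g t / bv.length) := Δ.glueLoop_of_mem g ht
  rw [← dist_eq_norm]
  rcases le_or_gt t (g.m0 + g.τ) with c₁ | c₁
  · -- window 0: junction edge `a → α_a`
    have hw : t ∈ Icc g.m0 (g.m0 + g.τ) := ⟨ht.1, c₁⟩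
    have hu := unitProfile_mem g.b01 t
    have e : Δ.glueLoop g t = polygonLoop bv ((((0 : ℕ) : ℝ) + unitProfile g.m0 (g.m0 + g.τ) t) / bv.length) := by
      rw [eL, glueSum_of_mem₀ hw, Nat.cast_zero, zero_add]
    have d1 := Δ.dist_polygonLoop_edge_le' (k := 0) hN0 hu
    have e1 : bv[(0 + 1) % bv.length]'(Nat.mod_lt _ hN0) = pathCurve (Δ.α.map primalPt) 0 := by
      rw [Δ.pathCurve_alpha_zero]
      exact getElem_congr_idx (Nat.mod_eq_of_lt (by rw [hbv, length_boundaryVerts]; omega))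
    have d2 := h.distα 0
    rw [orderIso_apply_zero, hA0] at d2
    have d3 := dist_mul_boundary_le hR h hm0I htI (by rw [abs_le]; constructor <;> linarith [hw.1, hw.2])
    rw [e]
    rw [e1] at d1
    linarith [dist_triangle4 (polygonLoop bv ((((0 : ℕ) : ℝ) + unitProfile g.m0 (g.m0 + g.τ) t) / bv.length))
      (pathCurve (Δ.α.map primalPt) 0) ((R : ℂ) * J g.m0) (R * J t)]
  rcases le_or_gt t (g.m1 - g.τ) with c₂ | c₂
  · -- window 1: the `α`-block
    have hw : t ∈ Icc (g.m0 + g.τ) (g.m1 - g.τ) := ⟨c₁.le, c₂⟩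
    set s' : I := g.φa.symm (unitProfileI (g.m0 + g.τ) (g.m1 - g.τ) t) with hs'
    have e : Δ.glueLoop g t = pathCurve (Δ.α.map primalPt) s' := by
      rw [eL, glueSum_of_mem₁ hw, Δ.pathCurve_alpha_eq s']
    have d2 := h.distα s'
    have hφ : g.φa s' = unitProfileI (g.m0 + g.τ) (g.m1 - g.τ) t := by
      rw [hs', OrderIso.apply_symm_apply]
    set σ₁ := unitProfile (g.m0 + g.τ) (g.m1 - g.τ) t with hσ₁
    have hσ := unitProfile_mem g.b12 t
    have harc : D.arcA (g.φa s') = J (g.m0 + σ₁ * (g.m1 - g.m0)) := by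
      rw [hφ, D.arcA_apply, coe_unitProfileI g.b12, ← h.m0_eq, ← h.m1_eq]
    rw [harc] at d2
    have hmem : g.m0 + σ₁ * (g.m1 - g.m0) ∈ Icc g.m0 (g.m0 + 1) := by
      constructor
      · nlinarith [hσ.1, g.m0_lt_m1]
      · nlinarith [hσ.2, g.m0_lt_m1, g.m1_lt]
    have d3 := dist_mul_boundary_le hR h hmem htI (abs_affine_sub_le g.τ_pos g.b12 hw)
    rw [e]
    linarith [dist_triangle (pathCurve (Δ.α.map primalPt) s') ((R : ℂ) * J (g.m0 + σ₁ * (g.m1 - g.m0)))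
      (R * J t)]
  rcases le_or_gt t g.m1 with c₃ | c₃
  · -- window 2: junction edge `α_b → b`
    have hw : t ∈ Icc (g.m1 - g.τ) g.m1 := ⟨c₂.le, c₃⟩
    have hu := unitProfile_mem g.b23 t
    have hk : Δ.α.length < bv.length := by rw [hbv, length_boundaryVerts]; omega
    have e : Δ.glueLoop g t =
        polygonLoop bv (((Δ.α.length : ℝ) + unitProfile (g.m1 - g.τ) g.m1 t) / bv.length) := by
      rw [eL, glueSum_of_mem₂ hw]
    have d1 := Δ.dist_polygonLoop_edge_le hk hu
    rw [polygonLoop_vertex hk, ← Δ.pathCurve_alpha_one] at d1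
    have d2 := h.distα 1
    rw [orderIso_apply_one, hA1] at d2
    have d3 := dist_mul_boundary_le hR h hm1I htI (by rw [abs_le]; constructor <;> linarith [hw.1, hw.2])
    rw [e]
    linarith [dist_triangle4 (polygonLoop bv (((Δ.α.length : ℝ) + unitProfile (g.m1 - g.τ) g.m1 t) / bv.length))
      (pathCurve (Δ.α.map primalPt) 1) ((R : ℂ) * J g.m1) (R * J t)]
  rcases le_or_gt t (g.m1 + g.τ) with c₄ | c₄
  · -- window 3: junction edge `b → β_b`
    have hw : t ∈ Icc g.m1 (g.m1 + g.τ) := ⟨c₃.le, c₄⟩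
    have hu := unitProfile_mem g.b34 t
    have hk : Δ.α.length + 1 < bv.length := by rw [hbv, length_boundaryVerts]; omega
    have e : Δ.glueLoop g t =
        polygonLoop bv ((((Δ.α.length + 1 : ℕ) : ℝ) + unitProfile g.m1 (g.m1 + g.τ) t) / bv.length) := by
      rw [eL, glueSum_of_mem₃ hw]; push_cast; ring_nf
    have d1 := Δ.dist_polygonLoop_edge_le' hk hu
    have e1 : bv[(Δ.α.length + 1 + 1) % bv.length]'(Nat.mod_lt _ hN0) = pathCurve (Δ.β.map dualPt) 1 := by
      rw [Δ.pathCurve_beta_one]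
      exact getElem_congr_idx (by rw [Nat.mod_eq_of_lt (by rw [hbv, length_boundaryVerts]; omega)])
    rw [e1] at d1
    have d2 := h.distβ 1
    rw [orderIso_apply_one, hB1] at d2
    have d3 := dist_mul_boundary_le hR h hm1I htI (by rw [abs_le]; constructor <;> linarith [hw.1, hw.2])
    rw [e]
    linarith [dist_triangle4
      (polygonLoop bv ((((Δ.α.length + 1 : ℕ) : ℝ) + unitProfile g.m1 (g.m1 + g.τ) t) / bv.length))
      (pathCurve (Δ.β.map dualPt) 1) ((R : ℂ) * J g.m1) (R * J t)]
  rcases le_or_gt t (g.m0 + 1 - g.τ) with c₅ | c₅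
  · -- window 4: the `β`-block, backwards
    have hw : t ∈ Icc (g.m1 + g.τ) (g.m0 + 1 - g.τ) := ⟨c₄.le, c₅⟩
    set s' : I := g.φb.symm (σ (unitProfileI (g.m1 + g.τ) (g.m0 + 1 - g.τ) t)) with hs'
    have e : Δ.glueLoop g t = pathCurve (Δ.β.map dualPt) s' := by
      rw [eL, glueSum_of_mem₄ hw, Δ.pathCurve_beta_eq s']
    have d2 := h.distβ s'
    have hφ : g.φb s' = σ (unitProfileI (g.m1 + g.τ) (g.m0 + 1 - g.τ) t) := by
      rw [hs', OrderIso.apply_symm_apply]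
    set σ₄ := unitProfile (g.m1 + g.τ) (g.m0 + 1 - g.τ) t with hσ₄
    have hσ := unitProfile_mem g.b45 t
    have harc : D.arcB (g.φb s') = J (g.m1 + σ₄ * (g.m0 + 1 - g.m1)) := by
      rw [hφ, D.arcB_apply, unitInterval.coe_symm_eq, coe_unitProfileI g.b45, ← h.m0_eq, ← h.m1_eq]
      congr 1; ring
    rw [harc] at d2
    have hmem : g.m1 + σ₄ * (g.m0 + 1 - g.m1) ∈ Icc g.m0 (g.m0 + 1) := by
      constructor
      · nlinarith [hσ.1, g.m0_lt_m1, g.m1_lt]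
      · nlinarith [hσ.2, g.m1_lt]
    have hτ : |g.m1 + σ₄ * (g.m0 + 1 - g.m1) - t| ≤ g.τ := by
      have := abs_affine_sub_le (p := g.m1) (q := g.m0 + 1) g.τ_pos (by linarith [g.b45]) (t := t)
        ⟨hw.1, by linarith [hw.2]⟩
      rw [show g.m0 + 1 - g.τ = g.m0 + 1 - g.τ from rfl] at this
      convert this using 3
    have d3 := dist_mul_boundary_le hR h hmem htI hτ
    rw [e]
    linarith [dist_triangle (pathCurve (Δ.β.map dualPt) s') ((R : ℂ) * J (g.m1 + σ₄ * (g.m0 + 1 - g.m1)))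
      (R * J t)]
  · -- window 5: junction edge `β_a → a`
    have hw : t ∈ Icc (g.m0 + 1 - g.τ) (g.m0 + 1) := ⟨c₅.le, ht.2.le⟩
    have hu := unitProfile_mem g.b56 t
    have hk : Δ.α.length + Δ.β.length + 1 < bv.length := by rw [hbv, length_boundaryVerts]; omega
    have e : Δ.glueLoop g t = polygonLoop bv
        ((((Δ.α.length + Δ.β.length + 1 : ℕ) : ℝ) + unitProfile (g.m0 + 1 - g.τ) (g.m0 + 1) t) / bv.length) := by
      rw [eL, glueSum_of_mem₅ hw]; push_cast; ring_nf
    have d1 := Δ.dist_polygonLoop_edge_le hk hu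
    rw [polygonLoop_vertex hk, ← Δ.pathCurve_beta_zero] at d1
    have d2 := h.distβ 0
    rw [orderIso_apply_zero, hB0] at d2
    have hper : J g.m0 = J (g.m0 + 1) := (D.toMarkedDomain.periodic_boundary g.m0).symm
    rw [hper] at d2
    have d3 := dist_mul_boundary_le hR h hm01I htI (by rw [abs_le]; constructor <;> linarith [hw.1, hw.2])
    rw [e]
    linarith [dist_triangle4 (polygonLoop bv
      ((((Δ.α.length + Δ.β.length + 1 : ℕ) : ℝ) + unitProfile (g.m0 + 1 - g.τ) (g.m0 + 1) t) / bv.length))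
      (pathCurve (Δ.β.map dualPt) 0) ((R : ℂ) * J (g.m0 + 1)) (R * J t)]

/-- **The re-timed boundary polygon stays within distance `13` of `R · J`**, for all times.
[cite: LawlerSchrammWerner2004, §4.3] -/
theorem norm_glueLoop_sub_le (hR : 0 < R) (h : g.Adapted D R Δ) (t : ℝ) :
    ‖Δ.glueLoop g t - R * D.toMarkedDomain.boundary t‖ ≤ 13 := by
  have key := norm_glueLoop_sub_le_of_mem hR h (reduce_mem g t)
  have hper : D.toMarkedDomain.boundary (g.m0 + Int.fract (t - g.m0)) = D.toMarkedDomain.boundary t := by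
    have e : t = g.m0 + Int.fract (t - g.m0) + ((⌊t - g.m0⌋ : ℤ) : ℝ) * 1 := by
      rw [mul_one]; linarith [Int.floor_add_fract (t - g.m0)]
    conv_rhs => rw [e]
    exact ((D.toMarkedDomain.periodic_boundary.int_mul ⌊t - g.m0⌋) _).symm
  rwa [← Δ.glueLoop_eq_reduce g t, hper] at key

end Estimate

end Domain

/-! ### From approximations to adapted gluing data -/

/-- **A reparametrisation realising a reparametrisation-distance bound**: if `ρ(γ₁, γ₂) < c`
then some increasing homeomorphism `φ` of `[0, 1]` has `dist (γ₁ t) (γ₂ (φ t)) < c` for all `t`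
([LSW04] §3.4: `ρ` is an infimum over such `φ`). [cite: LawlerSchrammWerner2004, §3.4] -/
theorem exists_reparam_of_reparamDist_lt {γ₁ γ₂ : Curve ℂ} {c : ℝ}
    (h : Curve.reparamDist γ₁ γ₂ < c) : ∃ φ : I ≃o I, ∀ t, dist (γ₁ t) (γ₂ (φ t)) < c := by
  obtain ⟨φ, hφ⟩ := exists_lt_of_ciInf_lt h
  exact ⟨φ, fun t ↦ (ContinuousMap.dist_apply_le_dist t).trans_lt hφ⟩

namespace SmoothDomain

variable (D : SmoothDomain)

/-- The two marked points of a smooth domain are distinct. [folklore] -/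
theorem pt_zero_ne_pt_one : D.toMarkedDomain.pt 0 ≠ D.toMarkedDomain.pt 1 := fun h ↦
  absurd (D.toMarkedDomain.pt_injective h) (by decide)

/-- **The gluing scale** of a smooth domain: above it every approximation has `α`- and
`β`-polylines with at least two points, so that the re-timed boundary loop is available.
[folklore] -/
def glueScale : ℝ := 22 / ‖D.toMarkedDomain.pt 0 - D.toMarkedDomain.pt 1‖ + 1

/-- The gluing scale is positive. [folklore] -/
theorem glueScale_pos : 0 < D.glueScale := by
  have : 0 ≤ 22 / ‖D.toMarkedDomain.pt 0 - D.toMarkedDomain.pt 1‖ := by positivity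
  unfold glueScale; linarith

/-- Above the gluing scale, `R · |a - b| > 22`. [folklore] -/
theorem lt_mul_norm_of_glueScale_le {R : ℝ} (hR : D.glueScale ≤ R) :
    22 < R * ‖D.toMarkedDomain.pt 0 - D.toMarkedDomain.pt 1‖ := by
  have hd : 0 < ‖D.toMarkedDomain.pt 0 - D.toMarkedDomain.pt 1‖ :=
    norm_pos_iff.2 (sub_ne_zero.2 D.pt_zero_ne_pt_one)
  have h1 : 22 / ‖D.toMarkedDomain.pt 0 - D.toMarkedDomain.pt 1‖ < R := by
    unfold glueScale at hR; linarith
  rwa [div_lt_iff₀ hd] at h1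

end SmoothDomain

namespace IsApproximation

variable {D : SmoothDomain} {R : ℝ} {Δ : Domain}

/-- A polyline within `ρ ≤ 10` of `R` times an arc from `a` to `b` cannot be a single point once
`R · |a - b| > 22`. [folklore] -/
theorem two_le_length_aux {L : List (ℤ × ℤ)} {f : ℤ × ℤ → ℂ} {arc : Curve ℂ} (hL : L ≠ [])
    (h0 : arc 0 = D.toMarkedDomain.pt 0) (h1 : arc 1 = D.toMarkedDomain.pt 1)
    (hρ : Curve.reparamDist (pathCurve (L.map f)) (scaleCurve R arc) ≤ 10)
    (hR : 22 < R * ‖D.toMarkedDomain.pt 0 - D.toMarkedDomain.pt 1‖) : 2 ≤ L.length := by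
  by_contra hlt
  have hlen : L.length = 1 := by
    have := List.length_pos_iff.2 hL; omega
  obtain ⟨p, rfl⟩ := List.length_eq_one_iff.1 hlen
  obtain ⟨φ, hφ⟩ := exists_reparam_of_reparamDist_lt (hρ.trans_lt (by norm_num : (10 : ℝ) < 11))
  have hc : ∀ t, pathCurve ([p].map f) t = f p := fun t ↦ by simp [pathCurve_apply]
  have d0 := hφ 0
  have d1 := hφ 1
  rw [hc, Domain.orderIso_apply_zero, scaleCurve_apply, h0] at d0
  rw [hc, Domain.orderIso_apply_one, scaleCurve_apply, h1] at d1
  have hR0 : 0 ≤ R := by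
    by_contra hneg
    have : R * ‖D.toMarkedDomain.pt 0 - D.toMarkedDomain.pt 1‖ ≤ 0 :=
      mul_nonpos_of_nonpos_of_nonneg (le_of_not_ge hneg) (norm_nonneg _)
    linarith
  have key : dist ((R : ℂ) * D.toMarkedDomain.pt 0) (R * D.toMarkedDomain.pt 1) < 22 := by
    linarith [dist_triangle_left ((R : ℂ) * D.toMarkedDomain.pt 0) (R * D.toMarkedDomain.pt 1) (f p)]
  rw [dist_eq_norm, ← mul_sub, norm_mul, Complex.norm_real, Real.norm_of_nonneg hR0] at key
  linarith

/-- **Above the gluing scale the polylines `α^R`, `β^R` have at least two points each.**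
[folklore] -/
theorem two_le_length (h : IsApproximation D R Δ) (hR : D.glueScale ≤ R) :
    2 ≤ Δ.α.length ∧ 2 ≤ Δ.β.length :=
  ⟨two_le_length_aux Δ.α_ne_nil D.arcA_zero D.arcA_one h.1 (D.lt_mul_norm_of_glueScale_le hR),
    two_le_length_aux Δ.β_ne_nil D.arcB_zero D.arcB_one h.2.1 (D.lt_mul_norm_of_glueScale_le hR)⟩

/-- **Adapted gluing data exist** for every approximation at positive scale: the marks are those
of `D`, the reparametrisations come from `ρ ≤ 10 < 11` ([LSW04] §3.4), and the junction width
`τ` from the uniform continuity of the boundary loop of `D` on the fundamental window and the gaps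
between the marks. [cite: LawlerSchrammWerner2004, §4.3] -/
theorem exists_adapted (h : IsApproximation D R Δ) (hR : 0 < R) : ∃ g : GlueData, g.Adapted D R Δ := by
  set m0 := D.toMarkedDomain.mark 0 with hm0
  set m1 := D.toMarkedDomain.mark 1 with hm1
  have hlt : m0 < m1 := D.toMarkedDomain.strictMono_mark (by decide : (0 : Fin 2) < 1)
  have hm1' : m1 < m0 + 1 := by
    have := (D.toMarkedDomain.mark_mem 1).2
    have := (D.toMarkedDomain.mark_mem 0).1
    linarith
  obtain ⟨φa, hφa⟩ := exists_reparam_of_reparamDist_lt (h.1.trans_lt (by norm_num : (10 : ℝ) < 11))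
  obtain ⟨φb, hφb⟩ := exists_reparam_of_reparamDist_lt (h.2.1.trans_lt (by norm_num : (10 : ℝ) < 11))
  -- uniform continuity of the boundary loop on the fundamental window
  have huc : UniformContinuousOn D.toMarkedDomain.boundary (Icc m0 (m0 + 1)) :=
    isCompact_Icc.uniformContinuousOn_of_continuous D.toMarkedDomain.continuous_boundary.continuousOn
  obtain ⟨δ, hδ, hδ'⟩ := Metric.uniformContinuousOn_iff.1 huc R⁻¹ (inv_pos.2 hR)
  set τ : ℝ := min (δ / 2) (min ((m1 - m0) / 4) ((m0 + 1 - m1) / 4)) with hτ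
  have hτδ : τ ≤ δ / 2 := min_le_left _ _
  have hτ1 : τ ≤ (m1 - m0) / 4 := (min_le_right _ _).trans (min_le_left _ _)
  have hτ2 : τ ≤ (m0 + 1 - m1) / 4 := (min_le_right _ _).trans (min_le_right _ _)
  have hτpos : 0 < τ := lt_min (by linarith) (lt_min (by linarith) (by linarith))
  refine ⟨⟨m0, m1, τ, φa, φb, hτpos, by linarith, by linarith⟩, rfl, rfl, ?_, ?_, ?_⟩
  · intro s; simpa using hφa s
  · intro s; simpa using hφb s
  · intro t ht t' ht' hd
    exact (hδ' t ht t' ht' (by rw [Real.dist_eq]; linarith)).le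

/-- **Chosen adapted gluing data** of an approximation. [folklore] -/
def glueData (h : IsApproximation D R Δ) (hR : 0 < R) : GlueData := (h.exists_adapted hR).choose

/-- The chosen gluing data are adapted. [folklore] -/
theorem adapted_glueData (h : IsApproximation D R Δ) (hR : 0 < R) : (h.glueData hR).Adapted D R Δ :=
  (h.exists_adapted hR).choose_spec

/-- **The rescaled approximation `R⁻¹ D^R` as a Jordan domain** with the re-timed boundary loop,
for `R` above the gluing scale. [cite: LawlerSchrammWerner2004, §4.3] -/
def jordan (h : IsApproximation D R Δ) (hR : D.glueScale ≤ R) : JordanDomain :=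
  Δ.approxJordan (h.glueData (D.glueScale_pos.trans_le hR)) (h.two_le_length hR).1 (h.two_le_length hR).2
    (D.glueScale_pos.trans_le hR)

/-- Its carrier is `R⁻¹ D^R`. [folklore] -/
@[simp] theorem jordan_carrier (h : IsApproximation D R Δ) (hR : D.glueScale ≤ R) :
    (h.jordan hR).carrier = (fun z : ℂ ↦ ((R : ℂ))⁻¹ * z) '' Δ.carrier := rfl

/-- Its boundary loop is the rescaled re-timed polygon. [folklore] -/
theorem jordan_boundary (h : IsApproximation D R Δ) (hR : D.glueScale ≤ R) (t : ℝ) :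
    (h.jordan hR).boundary t = ((R : ℂ))⁻¹ * Δ.glueLoop (h.glueData (D.glueScale_pos.trans_le hR)) t := rfl

/-- `0` lies in the rescaled approximation. [folklore] -/
theorem zero_mem_jordan (h : IsApproximation D R Δ) (hR : D.glueScale ≤ R) :
    (0 : ℂ) ∈ (h.jordan hR).carrier :=
  ⟨0, h.2.2, by simp⟩

/-- The frontier of the rescaled approximation is the rescaled boundary polygon. [folklore] -/
theorem frontier_jordan (h : IsApproximation D R Δ) (hR : D.glueScale ≤ R) :
    frontier (h.jordan hR).carrier = (fun z : ℂ ↦ ((R : ℂ))⁻¹ * z) '' frontier Δ.carrier := by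
  have hc : ((R : ℂ))⁻¹ ≠ 0 := inv_ne_zero (by exact_mod_cast (D.glueScale_pos.trans_le hR).ne')
  exact ((Homeomorph.mulLeft₀ ((R : ℂ))⁻¹ hc).image_frontier Δ.carrier).symm

/-- **The boundary loops of the rescaled approximations are uniformly `13/R`-close to the boundary
loop of `D`** ([LSW04] §4.3; the input of Radó's theorem). [cite: LawlerSchrammWerner2004, §4.3] -/
theorem dist_jordan_boundary_le (h : IsApproximation D R Δ) (hR : D.glueScale ≤ R) (t : ℝ) :
    dist ((h.jordan hR).boundary t) (D.toMarkedDomain.boundary t) ≤ 13 / R := by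
  have hR0 : 0 < R := D.glueScale_pos.trans_le hR
  have key := Domain.norm_glueLoop_sub_le hR0 (h.adapted_glueData hR0) t
  rw [jordan_boundary, dist_eq_norm]
  have e : ((R : ℂ))⁻¹ * Δ.glueLoop (h.glueData hR0) t - D.toMarkedDomain.boundary t =
      ((R : ℂ))⁻¹ * (Δ.glueLoop (h.glueData hR0) t - R * D.toMarkedDomain.boundary t) := by
    have : (R : ℂ) ≠ 0 := by exact_mod_cast hR0.ne'
    field_simp
  rw [e, norm_mul, norm_inv, Complex.norm_real, Real.norm_of_nonneg hR0.le, div_eq_inv_mul]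
  exact mul_le_mul_of_nonneg_left key (inv_nonneg.2 hR0.le)

/-- **The rescaled initial vertex `R⁻¹ a^R` is `12/R`-close to `a`.** [cite: LawlerSchrammWerner2004, §4.3] -/
theorem dist_a_le (h : IsApproximation D R Δ) (hR : D.glueScale ≤ R) :
    dist (((R : ℂ))⁻¹ * peanoPt Δ.a) (D.toMarkedDomain.pt 0) ≤ 12 / R := by
  have hR0 : 0 < R := D.glueScale_pos.trans_le hR
  have had := h.adapted_glueData hR0
  -- `a` is within `1` of `α_a = pathCurve α 0`, which is within `11` of `R a`
  have h1 : dist (peanoPt Δ.a) (pathCurve (Δ.α.map primalPt) 0) ≤ 1 := by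
    rw [Δ.pathCurve_alpha_zero, dist_comm, dist_eq_norm]
    have := Δ.norm_sub_boundaryVerts_le_one 0 (by simp)
    simpa using this
  have h2 := had.distα 0
  rw [Domain.orderIso_apply_zero, D.arcA_zero] at h2
  have h3 : dist (peanoPt Δ.a) ((R : ℂ) * D.toMarkedDomain.pt 0) < 12 := by
    linarith [dist_triangle (peanoPt Δ.a) (pathCurve (Δ.α.map primalPt) 0) ((R : ℂ) * D.toMarkedDomain.pt 0)]
  have e : ((R : ℂ))⁻¹ * peanoPt Δ.a - D.toMarkedDomain.pt 0 =
      ((R : ℂ))⁻¹ * (peanoPt Δ.a - R * D.toMarkedDomain.pt 0) := by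
    have : (R : ℂ) ≠ 0 := by exact_mod_cast hR0.ne'
    field_simp
  rw [dist_eq_norm, e, norm_mul, norm_inv, Complex.norm_real, Real.norm_of_nonneg hR0.le, ← dist_eq_norm,
    div_eq_inv_mul]
  exact mul_le_mul_of_nonneg_left h3.le (inv_nonneg.2 hR0.le)

/-- **The rescaled terminal vertex `R⁻¹ b^R` is `12/R`-close to `b`.** [cite: LawlerSchrammWerner2004, §4.3] -/
theorem dist_b_le (h : IsApproximation D R Δ) (hR : D.glueScale ≤ R) :
    dist (((R : ℂ))⁻¹ * peanoPt Δ.b) (D.toMarkedDomain.pt 1) ≤ 12 / R := by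
  have hR0 : 0 < R := D.glueScale_pos.trans_le hR
  have had := h.adapted_glueData hR0
  have hnα : 1 ≤ Δ.α.length := List.length_pos_iff.2 Δ.α_ne_nil
  -- `b` is within `1` of `α_b = pathCurve α 1`, which is within `11` of `R b`
  have h1 : dist (peanoPt Δ.b) (pathCurve (Δ.α.map primalPt) 1) ≤ 1 := by
    rw [Δ.pathCurve_alpha_one, dist_eq_norm]
    have hk : Δ.α.length < (boundaryVerts Δ.α Δ.β Δ.a Δ.b).length := by simp; omega
    have := Δ.norm_sub_boundaryVerts_le_one Δ.α.length hk
    have e : (boundaryVerts Δ.α Δ.β Δ.a Δ.b)[(Δ.α.length + 1) % (boundaryVerts Δ.α Δ.β Δ.a Δ.b).length]'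
        (Nat.mod_lt _ (by simp)) = peanoPt Δ.b := by
      rw [← boundaryVerts_length_succ Δ.α Δ.β Δ.a Δ.b]
      exact getElem_congr_idx (Nat.mod_eq_of_lt (by simp))
    rwa [e] at this
  have h2 := had.distα 1
  rw [Domain.orderIso_apply_one, D.arcA_one] at h2
  have h3 : dist (peanoPt Δ.b) ((R : ℂ) * D.toMarkedDomain.pt 1) < 12 := by
    linarith [dist_triangle (peanoPt Δ.b) (pathCurve (Δ.α.map primalPt) 1) ((R : ℂ) * D.toMarkedDomain.pt 1)]
  have e : ((R : ℂ))⁻¹ * peanoPt Δ.b - D.toMarkedDomain.pt 1 =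
      ((R : ℂ))⁻¹ * (peanoPt Δ.b - R * D.toMarkedDomain.pt 1) := by
    have : (R : ℂ) ≠ 0 := by exact_mod_cast hR0.ne'
    field_simp
  rw [dist_eq_norm, e, norm_mul, norm_inv, Complex.norm_real, Real.norm_of_nonneg hR0.le, ← dist_eq_norm,
    div_eq_inv_mul]
  exact mul_le_mul_of_nonneg_left h3.le (inv_nonneg.2 hR0.le)

/-- The rescaled marked vertices lie on the frontier of the rescaled approximation. [folklore] -/
theorem a_mem_frontier_jordan (h : IsApproximation D R Δ) (hR : D.glueScale ≤ R) :
    ((R : ℂ))⁻¹ * peanoPt Δ.a ∈ frontier (h.jordan hR).carrier := by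
  rw [h.frontier_jordan hR]; exact ⟨_, Δ.peanoPt_a_mem_frontier, rfl⟩

/-- The rescaled marked vertices lie on the frontier of the rescaled approximation. [folklore] -/
theorem b_mem_frontier_jordan (h : IsApproximation D R Δ) (hR : D.glueScale ≤ R) :
    ((R : ℂ))⁻¹ * peanoPt Δ.b ∈ frontier (h.jordan hR).carrier := by
  rw [h.frontier_jordan hR]; exact ⟨_, Δ.peanoPt_b_mem_frontier, rfl⟩

end IsApproximation

/-- **Uniform convergence of the boundary loops along approximations** `D^{Rₙ}`, `Rₙ → ∞`
([LSW04] §4.3; the input of Radó's theorem, Pommerenke (1992) Thm. 2.11 / Cor. 2.4): eventually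
`Rₙ` exceeds the gluing scale and the re-timed boundary loops of `Rₙ⁻¹ D^{Rₙ}` are `ε`-close to the
boundary loop of `D`, uniformly in time. [cite: LawlerSchrammWerner2004, §4.3] -/
theorem eventually_dist_jordan_boundary_lt (D : SmoothDomain) {R : ℕ → ℝ} {Δ : ℕ → Domain}
    (hR : Tendsto R atTop atTop) (hΔ : ∀ n, IsApproximation D (R n) (Δ n)) {ε : ℝ} (hε : 0 < ε) :
    ∀ᶠ n in atTop, ∃ hn : D.glueScale ≤ R n,
      ∀ t, dist (((hΔ n).jordan hn).boundary t) (D.toMarkedDomain.boundary t) < ε := by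
  filter_upwards [hR.eventually_ge_atTop D.glueScale, hR.eventually_gt_atTop (13 / ε)] with n hn hn'
  refine ⟨hn, fun t ↦ ((hΔ n).dist_jordan_boundary_le hn t).trans_lt ?_⟩
  have hR0 : 0 < R n := D.glueScale_pos.trans_le hn
  rw [div_lt_iff₀ hR0]
  rw [div_lt_iff₀ hε] at hn'
  linarith

end USTPeano

end Literature.Probability.RandomPlanarGeometry
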